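import Summits.NavierStokesRegularity.NavierStokesRegularity.Theses.HodographBetchov
import Literature.Analysis.FluidPDE.TaoLocalisationHolds
import Literature.Analysis.FluidPDE.H1ContinuationSobolevClass
import Literature.Analysis.FluidPDE.EnstrophyGronwall

/-!
# Crux `HodographBetchov.ClassBudgetsRegularise` (stmt-NavierStokesRegularity-16863), line `birth`,
# stub 2 `stub_enstrophyContinuation` — Leray's `H¹` continuation (PROVED)

Registered stub 2 of the skeleton `Cruxes/ClassBudgetsRegularise/Lines/birth.lean`: a classical
solution of the unforced Navier–Stokes system on `ℝ³ × [0, T)` which is Leray–Hopf from its rapidly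
decaying datum and whose enstrophy `∫ ‖∇u(t)‖²` is bounded on `[0, T)` extends classically past `T`.

Proof (every ingredient is a theorem of the tree): Tao 2013, Cor. 11.1 + Cor. 4.3 + Thm. 5.4 (iv)
(`tao2011_hasBoundedSobolevNormsOn_holds`) puts the solution in the Beale–Kato–Majda class on every
closed slab `[0, T₁]`, `T₁ < T` (the energy being bounded there by the Leray–Hopf energy
inequality); the energy inequality and the hypothesis give a uniform `H¹` bound on `[0, T)`
(`|∇u|²_F ≤ 3 ‖∇u‖ₒₚ²`), so the restart-and-glue theorem
`hasSobolevExtensionPast_of_uniform_H1_bound` (Tao's `H¹` lifespan + Majda–Bertozzi uniqueness)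
continues the solution in the class past `T`, in particular smoothly
(`HasSobolevExtensionPast.hasSmoothExtensionPast`).

References: J. Leray, Acta Math. 63 (1934), §§19–22; P. G. Lemarié-Rieusset, *The Navier–Stokes
Problem in the 21st Century* (2016), Thm. 11.7 (proof); T. Tao, Anal. PDE 6 (2013), Thm. 5.4,
Cor. 11.1.
-/

noncomputable section

open Set MeasureTheory Filter Topology Function
open scoped ENNReal NNReal InnerProductSpace

-- the summit and its single sub-problem share the name (CONVENTIONS §1), as in every Theorems file
set_option linter.dupNamespace false

namespace Summit.NavierStokesRegularity.NavierStokesRegularity.Theorems.ClassBudgetsRegularise.Birth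

open Literature.Analysis Literature.Analysis.FluidPDE

/-- **stub 2 — `stub_enstrophyContinuation` (Leray's `H¹` continuation: enstrophy controls the
lifespan).** For `ν, T > 0` and a classical solution `(u, p)` of the unforced Navier–Stokes system
on `ℝ³ × [0, T)` which is Leray–Hopf from its rapidly decaying datum: if the enstrophy is bounded on
`[0, T)`, `∫ ‖∇u(t)‖² ≤ E`, then `u` extends as a classical solution past `T`.
Proof: the solution lies in the Beale–Kato–Majda class on every closed slab `[0, T₁]`, `T₁ < T`
(Tao 2013, `tao2011_hasBoundedSobolevNormsOn_holds`, energy bounded by the Leray–Hopf energy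
inequality `IsLerayHopfOn.lintegral_enorm_sq_le`); with `|∇u|²_F ≤ 3‖∇u‖²` the hypothesis is a
uniform `H¹` bound on `[0, T)`, and `hasSobolevExtensionPast_of_uniform_H1_bound` (restart with
Tao's `H¹` lifespan, Majda–Bertozzi uniqueness, glue) continues `u` in the class past `T`. -/
theorem stub_enstrophyContinuation :
    ∀ (ν T : ℝ), 0 < ν → 0 < T → ∀ (u : ℝ → EuclideanSpace ℝ (Fin 3) → EuclideanSpace ℝ (Fin 3))
      (p : ℝ → EuclideanSpace ℝ (Fin 3) → ℝ),
      IsClassicalNSSolutionOn (Set.Ico 0 T) ν 0 u p → IsLerayHopfOn T ν 0 (u 0) u →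
      HasRapidSpatialDecay (u 0) →
      (∃ E : ℝ, ∀ t ∈ Set.Ico 0 T, ∫⁻ x, ‖fderiv ℝ (u t) x‖ₑ ^ 2 ≤ ENNReal.ofReal E) →
      HasSmoothExtensionPast ν 0 u T := by
  intro ν T hν hT u p hcl hLH hdec hE
  obtain ⟨E, hE⟩ := hE
  -- Step 1: the BKM class on closed slabs `[0, T₁]`, `0 < T₁ < T` (Tao 2013, Cor. 11.1)
  have hslab : ∀ T₁ ∈ Ioo 0 T, HasBoundedSobolevNormsOn (Icc 0 T₁) u := by
    intro T₁ hT₁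
    have hsol' : IsClassicalNSSolutionOn (Icc 0 T₁) ν 0 u p :=
      hcl.mono (Icc_subset_Ico_right hT₁.2) (uniqueDiffOn_Icc hT₁.1)
    have hEn' : ∃ C : ℝ≥0, ∀ t ∈ Icc 0 T₁, ∫⁻ x, ‖u t x‖ₑ ^ 2 ≤ C :=
      ⟨(2 * VectorCalculus.kineticEnergy (u 0)).toNNReal, fun t ht =>
        hLH.lintegral_enorm_sq_le hν.le ⟨ht.1, ht.2.trans hT₁.2.le⟩⟩
    exact tao2011_hasBoundedSobolevNormsOn_holds hν hT₁.1 hsol' hEn' hdec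
  have hreg : ∀ T'' < T, HasBoundedSobolevNormsOn (Icc 0 T'') u := by
    intro T'' hT''
    have h1 : max T'' (T / 2) ∈ Ioo 0 T :=
      ⟨lt_max_of_lt_right (by linarith), max_lt hT'' (by linarith)⟩
    exact (hslab _ h1).mono (Icc_subset_Icc_right (le_max_left _ _))
  -- Step 2: the uniform `H¹` bound on `[0, T)`
  set A : ℝ := 2 * VectorCalculus.kineticEnergy (u 0) + 3 * max E 0 with hA
  have hKE : 0 ≤ 2 * VectorCalculus.kineticEnergy (u 0) :=
    mul_nonneg zero_le_two (kineticEnergy_nonneg _)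
  have hA0 : 0 ≤ A := by positivity
  have hAt : ∀ t ∈ Ico 0 T,
      (∫⁻ x, ‖u t x‖ₑ ^ 2) + (∫⁻ x, ENNReal.ofReal (frobeniusNormSq (fderiv ℝ (u t) x))) ≤
        ENNReal.ofReal A := by
    intro t ht
    have h1 : ∫⁻ x, ‖u t x‖ₑ ^ 2 ≤ ENNReal.ofReal (2 * VectorCalculus.kineticEnergy (u 0)) :=
      hLH.lintegral_enorm_sq_le hν.le ⟨ht.1, ht.2.le⟩
    have h2 : ∫⁻ x, ENNReal.ofReal (frobeniusNormSq (fderiv ℝ (u t) x)) ≤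
        ENNReal.ofReal (3 * max E 0) := by
      calc ∫⁻ x, ENNReal.ofReal (frobeniusNormSq (fderiv ℝ (u t) x))
          ≤ ∫⁻ x, 3 * ‖fderiv ℝ (u t) x‖ₑ ^ 2 :=
            lintegral_mono fun x => ofReal_frobeniusNormSq_le_three_mul_enorm_sq _
        _ = 3 * ∫⁻ x, ‖fderiv ℝ (u t) x‖ₑ ^ 2 := lintegral_const_mul' _ _ (by norm_num)
        _ ≤ 3 * ENNReal.ofReal (max E 0) := by
            gcongr
            exact (hE t ht).trans (ENNReal.ofReal_le_ofReal (le_max_left _ _))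
        _ = ENNReal.ofReal (3 * max E 0) := by
            rw [ENNReal.ofReal_mul (by norm_num), ENNReal.ofReal_ofNat]
    calc (∫⁻ x, ‖u t x‖ₑ ^ 2) + (∫⁻ x, ENNReal.ofReal (frobeniusNormSq (fderiv ℝ (u t) x)))
        ≤ ENNReal.ofReal (2 * VectorCalculus.kineticEnergy (u 0)) + ENNReal.ofReal (3 * max E 0) :=
          add_le_add h1 h2
      _ = ENNReal.ofReal A := by
          rw [hA, ENNReal.ofReal_add hKE (by positivity)]
  -- Step 3: continuation in the class, hence smoothly
  exact (hasSobolevExtensionPast_of_uniform_H1_bound hν hT hcl hreg hA0 hAt).hasSmoothExtensionPast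

end Summit.NavierStokesRegularity.NavierStokesRegularity.Theorems.ClassBudgetsRegularise.Birth

end
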